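import Literature.Probability.RandomPlanarGeometry.SLEKappaRhoAssembly
import Literature.Probability.RandomPlanarGeometry.SLEKappaRhoDriving
import Literature.Probability.RandomPlanarGeometry.SLEKappaRhoBesselEquation
import Literature.Probability.RandomPlanarGeometry.SLERestrictionHitReduction
import Literature.Probability.RandomPlanarGeometry.SLERestrictionHitStolz
import Literature.Probability.RandomPlanarGeometry.CritPercSLESimplePathProofs
import Literature.Probability.RandomPlanarGeometry.RestrictionMeasuresFiveEighthsPositivity
import Literature.Probability.RandomPlanarGeometry.RestrictionExponent
import HarnessLib

/-!
# [LSW] Lemma 8.3 (2) for `ρ ≤ 0` (positive points are never swallowed), and the Cor. 8.6 input from four leaves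

Proof file for the named fact
`Literature.Probability.RandomPlanarGeometry.exists_isRightRestrictionMeasure_lt_five_eighths`
(`OneSidedRestriction`: "for `0 < α < 5/8` the right-sided restriction measure `P⁺_α` exists and
`P⁺_α{i ∉ K} > 1/2`"), after

* G. F. Lawler, O. Schramm, W. Werner, *Conformal restriction: the chordal case*, J. Amer. Math.
  Soc. **16** (2003) 917–955, arXiv:math/0209343 (**[LSW]**), Lemma 8.3 (p. 36) and its proof,
  Thm. 8.4 (p. 37), the proof of Cor. 8.6 (p. 38).

State of the tree (files `SLEKappaRho`, `SLEKappaRhoAssembly`, `SLEKappaRhoAsymmetry`,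
`SLEKappaRhoDriving`): the fact follows (`exists_isRightRestrictionMeasure_lt_five_eighths_of_sleKappaRho`)
from [LSW] Thm. 8.4 in law form (`SLEKappaRho.isRightRestrictionMeasure_fill`, itself assembled
from five leaves in `SLEKappaRho.isRightRestrictionMeasure_fill_of_weak_leaves`) and the asymmetry
of SLE(8/3, ρ), `ρ < 0` (`SLEKappaRho.one_half_lt_measure_I_notMem_fill`, from three leaves in
`SLEKappaRho.one_half_lt_measure_I_notMem_fill_of_leaves`). Of these leaves, `∫₀ᵗ du/Z_u < ∞`
(`SLEKappaRho.integral_inv_eq_holds`), Lemma 8.3 (4) (`SLEKappaRho.not_isBounded_hullUnion_holds`)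
and Lemma 6.3 (`restrictionDerivVanishesAtHit_of_stolz IsSmoothHull.hitPath_stolz_holds`) are
proved in the tree. This file removes one more leaf ON THE RANGE THE FACT NEEDS (`0 < α < 5/8`,
i.e. `−2 < ρ < 0`):

* PROVED — **[LSW] Lemma 8.3 (2) on the positive axis for `−2 < ρ ≤ 0`** (`0 < κ ≤ 4`): almost
  surely no `x > 0` is ever swallowed by the SLE(κ, ρ) chain
  (`SLEKappaRho.ae_swallowingTime_ofReal_eq_top_of_nonpos`). [LSW] (proof of Lemma 8.3, p. 36)
  argue on `x̃_t = g_t(1) − W_t` by comparison with a Bessel process (for `ρ ≠ 0` through the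
  equicontinuity of the laws of `B_t + ct` and `B_t`). Here, for `ρ ≤ 0`, we use instead the first
  sentence of the proof of Cor. 8.6 (p. 38): "when `ρ < 0`, `W_t − √κ B_t` is decreasing" — by
  §8.3, `W_t = √κ B_t + ρ ∫₀ᵗ du/Z_u` (`SLEKappaRho.ae_snd_eq_of`) — together with a
  DETERMINISTIC comparison of the real Loewner flows of two continuous driving functions `W ≤ U`
  with `U − W` non-decreasing (`Loewner.IsSolution.re_sub_driving_le_of_monotone`,
  `Loewner.swallowingTime_le_of_monotone_sub`: the driving function further to the left swallows
  a point `x > U_0` later, `T^U_x ≤ T^W_x`), and the non-swallowing of positive points by ordinary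
  SLE_κ, `κ ≤ 4` (`sle_swallowingTime_ofReal_eq_top_holds`, Lawler (2005) Prop. 6.8 / Rohde–Schramm
  Thm. 6.1, proved in the tree);
* PROVED — the bundle `SLEKappaRho.PairLeaves ρ W` of `SLEKappaRhoAssembly` for `−2 < ρ ≤ 0` from
  the single remaining random leaf, the martingale of Lemmas 8.9–8.10
  (`SLEKappaRho.pairLeaves_of_nonpos`), hence Thm. 8.4 in law form for `−2 < ρ ≤ 0` from that
  leaf and Lemma 6.2 (`IsSLEKappaRhoPair.isRightRestrictionMeasure_map_of_nonpos`);
* PROVED — **the fact from FOUR leaves** (`exists_isRightRestrictionMeasure_lt_five_eighths_of_four_leaves`):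
  `SLEKappaRho.exists_isOneSidedMartingale` (Lemmas 8.9–8.10), `Loewner.restrictionDeriv_exitTime_gt`
  (Lemma 6.2 for a general continuous driving function), `measure_I_notMem_leftFilling_sle_eq_half`
  ("which is `1/2` by symmetry", p. 38) and `SLEKappaRho.measure_I_notMem_fill_lt_of_neg` (the
  comparison sentence of p. 38). The discharge `exists_isRightRestrictionMeasure_lt_five_eighths_holds`
  is this theorem applied to the four `_holds`, once they exist.

Not here: Lemma 8.3 (2) for `ρ > 0` and Lemma 8.3 (3) (they are not needed for `α < 5/8`); no new
named fact is introduced.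

## Addendum (second part of the file): scale invariance of `P⁺_α`, fatness on the axis, and Lawler's route to the strict inequality

Since the first part was written, Lemma 6.2 (`Loewner.restrictionDeriv_exitTime_gt_holds`), the
symmetry sentence (`measure_I_notMem_leftFilling_sle_eq_half_holds`) and Lemma 8.3 (2) for all
`ρ > −2` became theorems of the tree, and `RestrictionMeasuresFiveEighthsProofs` reduces the fact
to TWO leaves (`exists_isRightRestrictionMeasure_lt_five_eighths_of_two_leaves`): the martingale
`hM` and the comparison sentence `SLEKappaRho.measure_I_notMem_fill_lt_of_neg` of [LSW] p. 38,
for which no proof is printed; `RestrictionMeasuresFiveEighthsPositivity` reduces the latter,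
given `hM`, to the positivity of `P⁺_β{i ∈ K}` for arbitrarily small `β > 0`
(`SLEKappaRho.measure_I_notMem_fill_lt_of_neg_of_martingale_of_pos`). This is the route of
G. F. Lawler, *Conformally Invariant Processes in the Plane*, AMS (2005), Cor. 9.11 (p. 219):
"Let `q(α)` be the probability that `i` lies in the hull distributed according to `P⁺_α`. The
construction above shows that `q(α) ∈ (0, 1)` […] since `P⁺_{α+β}` can be obtained from `P⁺_α`
and `P⁺_β` by taking unions, `q(α + β) ≥ q(α) + [1 − q(α)] q(β)`, and hence `q(α)` is strictly
increasing in `α`. Since […] `q(5/8) = 1/2`. Hence `q(α) < 1/2` for `α < 5/8`." The second part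
of this file PROVES:

* **scale invariance of `P⁺_α`** ([LSW] §8.1 p. 31: a right-sided restriction measure "is `𝒜₊`
  covariant and scale invariant"): the dilations `K ↦ λK` act measurably on `Ω₊`
  (`RightConfig.smul`), `λ_* P⁺_α = P⁺_α` (`IsRightRestrictionMeasure.map_smul_eq`, from
  `Φ'_{λA}(0) = Φ'_A(0)` and uniqueness), so `P⁺_α{λz ∉ K} = P⁺_α{z ∉ K}`
  (`IsRightRestrictionMeasure.measure_notMem_smul`, `…measure_mem_smul`);
* **fatness on the axis gives positivity**: `{(z, K) : z ∉ K}` is jointly measurable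
  (`RightConfig.measurableSet_prod_notMem`), `E_{P⁺_α}[Leb{y > 0 : iy ∈ K}] = Leb(0, ∞) · P⁺_α{i ∈ K}`
  by Fubini and scale invariance (`IsRightRestrictionMeasure.lintegral_volume_axis_mem`), hence
  `P⁺_α{i ∈ K} > 0` as soon as `K` contains a segment of the imaginary axis with positive
  probability (`IsRightRestrictionMeasure.measure_I_mem_pos_of_lintegral_ne_zero`) — the Fubini
  half of Lawler's "`q(α) ∈ (0, 1)`", whose geometric half (fat samples) Lawler reads off the
  reflected-Brownian-excursion construction;
* **Lawler's strict inequality** (`IsRightRestrictionMeasure.measure_notMem_lt_of_add`, from the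
  tree's `IsRightRestrictionMeasure.measure_notMem_le_mul`) and **Cor. 9.11's conclusion from its
  three inputs** for the one-sided measures alone — existence of all `P⁺_γ`,
  `P⁺_{5/8}{i ∉ K} = 1/2`, small-`β` positivity — giving the asymmetry `P⁺_α{i ∉ K} > 1/2` for
  every `P⁺_α`, `0 < α < 5/8` (`IsRightRestrictionMeasure.one_half_lt_measure_notMem_I_of_pos`),
  and with it THIS FILE'S FACT from the same three inputs
  (`exists_isRightRestrictionMeasure_lt_five_eighths_of_exists_of_pos`) — the asymmetry is not a
  separate named fact: by the uniqueness of `P⁺_α` it is the second conjunct of the fact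
  (`OneSidedRestrictionFacts`);
* hence THIS FILE'S FACT `exists_isRightRestrictionMeasure_lt_five_eighths` (and the asymmetry
  leaf, and the asymmetry for every `P⁺_α`) from the martingale `hM` and the small-`β`
  positivity alone (`…_of_martingale_of_pos`), or from `hM` and the fatness of some small-exponent
  `P⁺_β` — in particular of the SLE(8/3, ρ) filling for `ρ` near `−2` — on the imaginary axis
  (`…_of_martingale_of_fat`, `…_of_martingale_of_sle_fat`). The positivity/fatness is NOT proved
  here and is kept as an explicit hypothesis (no named fact is introduced).
-/

noncomputable section

open Set Filter MeasureTheory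
open _root_.Topology
open UpperHalfPlane (upperHalfPlaneSet)
open scoped NNReal ENNReal
open Literature.Probability.Process (preWienerMeasure brownian)

namespace Literature.Probability.RandomPlanarGeometry

/-! ### Deterministic comparison of the real Loewner flows of two driving functions -/

namespace Loewner

variable {U W : ℝ≥0 → ℝ} {x : ℝ} {g g' : ℝ → ℂ} {T T' : WithTop ℝ≥0}

/-- **Comparison of the real Loewner flows of two driving functions.** Let `U`, `W` be continuous
driving functions with `W_0 ≤ U_0` and `t ↦ U_t − W_t` non-decreasing (so `W ≤ U`: `W` is `U`
pushed to the left by a non-decreasing amount), let `x > U_0` and let `g`, `g'` solve the chordal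
Loewner equation `ġ = 2/(g − W_t)`, `ġ' = 2/(g' − U_t)` from `x`. Then, as long as both are alive,
`g'_t − U_t ≤ g_t − W_t`: the point keeps at least the same distance from the driving function that
was pushed away from it. (The difference `f = (g − W) − (g' − U) = (g − g') + (U − W)` starts at
`U_0 − W_0 ≥ 0`; on an interval where `f < 0` one has `0 < g − W < g' − U`, so `g − g'` has
derivative `2/(g − W) − 2/(g' − U) > 0`, and `U − W` does not decrease: `f` cannot have become
negative.) The deterministic content of the first sentence of the proof of [LSW] Cor. 8.6 ("when
`ρ < 0`, `W_t − √κ B_t` is decreasing") as used for Lemma 8.3 (2). [folklore] -/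
theorem IsSolution.re_sub_driving_le_of_monotone (hU : Continuous U) (hW : Continuous W)
    (hmono : Monotone fun t : ℝ≥0 ↦ U t - W t) (h0 : W 0 ≤ U 0) (hx : U 0 < x)
    (h : IsSolution W x g T) (h' : IsSolution U x g' T')
    {t : ℝ} (ht : 0 ≤ t) (htT : (t.toNNReal : WithTop ℝ≥0) < T)
    (htT' : (t.toNNReal : WithTop ℝ≥0) < T') :
    (g' t).re - U t.toNNReal ≤ (g t).re - W t.toNNReal := by
  have hxW : W 0 < x := h0.trans_lt hx
  have hsub : Icc 0 t ⊆ {s : ℝ | 0 ≤ s ∧ (s.toNNReal : WithTop ℝ≥0) < T} := Icc_subset_timeDomain htT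
  have hsub' : Icc 0 t ⊆ {s : ℝ | 0 ≤ s ∧ (s.toNNReal : WithTop ℝ≥0) < T'} :=
    Icc_subset_timeDomain htT'
  have him : ∀ s ∈ Icc 0 t, (g s).im = 0 := fun s hs ↦
    IsSolution.im_eq_zero_holds h (Complex.ofReal_im x) s hs.1 (hsub hs).2
  have him' : ∀ s ∈ Icc 0 t, (g' s).im = 0 := fun s hs ↦
    IsSolution.im_eq_zero_holds h' (Complex.ofReal_im x) s hs.1 (hsub' hs).2
  -- positivity of `g − W` and `g' − U` on `[0, t]`
  have hp : ∀ s ∈ Icc 0 t, 0 < (g s).re - W s.toNNReal := fun s hs ↦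
    sub_pos.2 (h.driving_lt_re hW hxW hs.1 (hsub hs).2)
  have hp' : ∀ s ∈ Icc 0 t, 0 < (g' s).re - U s.toNNReal := fun s hs ↦
    sub_pos.2 (h'.driving_lt_re hU hx hs.1 (hsub' hs).2)
  -- the difference `f = (g − W) − (g' − U)` and the last time `s₀ ≤ t` at which `f ≥ 0`
  set f : ℝ → ℝ := fun s ↦ ((g s).re - W s.toNNReal) - ((g' s).re - U s.toNNReal) with hfdef
  by_contra hlt
  rw [not_le] at hlt
  have hft : f t < 0 := by
    simp only [hfdef]
    linarith
  have hWc : Continuous fun s : ℝ ↦ W s.toNNReal := hW.comp continuous_real_toNNReal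
  have hUc : Continuous fun s : ℝ ↦ U s.toNNReal := hU.comp continuous_real_toNNReal
  have hcontf : ContinuousOn f (Icc 0 t) :=
    ((Complex.continuous_re.comp_continuousOn (h.continuousOn.mono hsub)).sub hWc.continuousOn).sub
      ((Complex.continuous_re.comp_continuousOn (h'.continuousOn.mono hsub')).sub hUc.continuousOn)
  set S : Set ℝ := Icc 0 t ∩ f ⁻¹' Ici 0 with hSdef
  have hS : IsClosed S := hcontf.preimage_isClosed_of_isClosed isClosed_Icc isClosed_Ici
  have hf0 : 0 ≤ f 0 := by
    simp only [hfdef, h.apply_zero, h'.apply_zero, Complex.ofReal_re, Real.toNNReal_zero]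
    linarith
  have h0S : (0 : ℝ) ∈ S := ⟨⟨le_rfl, ht⟩, hf0⟩
  have hSbdd : BddAbove S := ⟨t, fun s hs ↦ hs.1.2⟩
  set s₀ := sSup S with hs₀def
  have hs₀S : s₀ ∈ S := hS.csSup_mem ⟨0, h0S⟩ hSbdd
  have hs₀0 : 0 ≤ s₀ := hs₀S.1.1
  have hs₀t : s₀ ≤ t := hs₀S.1.2
  have hfs₀ : 0 ≤ f s₀ := hs₀S.2
  have hs₀lt : s₀ < t := by
    rcases eq_or_lt_of_le hs₀t with h0 | h0
    · exfalso
      rw [h0] at hfs₀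
      exact absurd hft (not_lt.2 hfs₀)
    · exact h0
  -- after `s₀`, `f < 0`
  have hfneg : ∀ s, s₀ < s → s ≤ t → f s < 0 := by
    intro s hs₀s hst
    by_contra hge
    rw [not_lt] at hge
    have hsS : s ∈ S := ⟨⟨hs₀0.trans hs₀s.le, hst⟩, hge⟩
    exact absurd (le_csSup hSbdd hsS) (not_le.2 hs₀s)
  -- `F s = re g s − re g' s` is non-decreasing on `[s₀, t]`
  have hsub₀ : Icc s₀ t ⊆ Icc 0 t := Icc_subset_Icc hs₀0 le_rfl
  have hsubD₀ : Icc s₀ t ⊆ {s : ℝ | 0 ≤ s ∧ (s.toNNReal : WithTop ℝ≥0) < T} := hsub₀.trans hsub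
  have hsubD₀' : Icc s₀ t ⊆ {s : ℝ | 0 ≤ s ∧ (s.toNNReal : WithTop ℝ≥0) < T'} := hsub₀.trans hsub'
  have hF : ∀ s ∈ Icc s₀ t, HasDerivWithinAt (fun s ↦ (g s).re - (g' s).re)
      (2 / ((g s).re - W s.toNNReal) - 2 / ((g' s).re - U s.toNNReal)) (Icc s₀ t) s := by
    intro s hs
    have h1 : HasDerivWithinAt (fun s ↦ (g s).re) (vectorField W s (g s)).re (Icc s₀ t) s :=
      Complex.reCLM.hasFDerivAt.comp_hasDerivWithinAt s
        ((h.isIntegralCurveOn s (hsubD₀ hs)).mono hsubD₀)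
    have h1' : HasDerivWithinAt (fun s ↦ (g' s).re) (vectorField U s (g' s)).re (Icc s₀ t) s :=
      Complex.reCLM.hasFDerivAt.comp_hasDerivWithinAt s
        ((h'.isIntegralCurveOn s (hsubD₀' hs)).mono hsubD₀')
    rw [re_vectorField_of_im_eq_zero W s (him s (hsub₀ hs))] at h1
    rw [re_vectorField_of_im_eq_zero U s (him' s (hsub₀ hs))] at h1'
    exact h1.sub h1'
  have hmonoF : MonotoneOn (fun s ↦ (g s).re - (g' s).re) (Icc s₀ t) := by
    refine monotoneOn_of_hasDerivWithinAt_nonneg (convex_Icc s₀ t)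
      (fun s hs ↦ (hF s hs).continuousWithinAt)
      (fun s hs ↦ (hF s (interior_subset hs)).mono interior_subset) fun s hs ↦ ?_
    rw [interior_Icc] at hs
    have hsI : s ∈ Icc 0 t := hsub₀ ⟨hs.1.le, hs.2.le⟩
    set P := (g s).re - W s.toNNReal with hP
    set P' := (g' s).re - U s.toNNReal with hP'
    have hPpos : 0 < P := hp s hsI
    have hfs : f s < 0 := hfneg s hs.1 hs.2.le
    have hPP' : P ≤ P' := by
      have : f s = P - P' := by simp only [hfdef, hP, hP']
      rw [this] at hfs
      linarith
    exact sub_nonneg.2 (div_le_div_of_nonneg_left (by norm_num) hPpos hPP')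
  have hend := hmonoF ⟨le_rfl, hs₀lt.le⟩ ⟨hs₀lt.le, le_rfl⟩ hs₀lt.le
  -- `U − W` does not decrease between `s₀` and `t`
  have hD := hmono (Real.toNNReal_le_toNNReal hs₀lt.le)
  simp only at hD hend
  have hdecomp : ∀ s, f s = ((g s).re - (g' s).re) + (U s.toNNReal - W s.toNNReal) := fun s ↦ by
    simp only [hfdef]
    ring
  have : 0 ≤ f t := by
    rw [hdecomp t]
    have h1 := hdecomp s₀
    linarith
  exact absurd hft (not_lt.2 this)

/-- **The driving function further to the left swallows a point on its right later**: for
continuous driving functions `U`, `W` with `W_0 ≤ U_0` and `t ↦ U_t − W_t` non-decreasing, and a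
real point `x > U_0`, the swallowing times satisfy `T^U_x ≤ T^W_x`. (If `T^W_x < T^U_x`, then on
`[0, T^W_x)` the `W`-flow of `x` stays at distance `≥ g'_t − U_t ≥ δ > 0` from `W`, `g'` the
`U`-flow of `x`, alive on the compact interval `[0, T^W_x]` — contradicting the extension criterion
`IsSolution.coe_lt_swallowingTime_of_le_norm_sub`.) [folklore] -/
theorem swallowingTime_le_of_monotone_sub (hU : Continuous U) (hW : Continuous W)
    (hmono : Monotone fun t : ℝ≥0 ↦ U t - W t) (h0 : W 0 ≤ U 0) (hx : U 0 < x) :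
    swallowingTime U x ≤ swallowingTime W x := by
  by_contra hcon
  rw [not_le] at hcon
  have hxW : W 0 < x := h0.trans_lt hx
  have hx0 : (x : ℂ) ≠ W 0 := fun he ↦ by
    have := congrArg Complex.re he
    simp only [Complex.ofReal_re] at this
    exact hxW.ne' this
  have hx0' : (x : ℂ) ≠ U 0 := fun he ↦ by
    have := congrArg Complex.re he
    simp only [Complex.ofReal_re] at this
    exact hx.ne' this
  obtain ⟨g₁, hg₁⟩ := exists_isSolution_swallowingTime_holds hU hx0'
  obtain ⟨g₂, hg₂⟩ := exists_isSolution_swallowingTime_holds hW hx0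
  -- the finite lifetime `b` of the `W`-flow of `x`
  have hbT : swallowingTime W x ≠ ⊤ := ne_top_of_lt hcon
  obtain ⟨b, hb⟩ := WithTop.ne_top_iff_exists.1 hbT
  rw [← hb] at hg₂ hcon
  have hb0 : 0 < b := by
    have := swallowingTime_pos_holds hW hx0
    rw [← hb] at this
    exact WithTop.coe_pos.1 this
  -- the `U`-flow `g₁` is alive on `[0, b]`, at distance `≥ δ` from `U`
  have hbT₁ : ((b : ℝ).toNNReal : WithTop ℝ≥0) < swallowingTime U x := by rwa [Real.toNNReal_coe]
  obtain ⟨δ, hδ, hfar⟩ := hg₁.exists_le_norm_sub hU b.coe_nonneg hbT₁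
  have hfar₂ : ∀ t : ℝ, 0 ≤ t → t < b → (δ : ℝ) ≤ ‖g₂ t - W t.toNNReal‖ := by
    intro t ht htb
    have htT₁ : (t.toNNReal : WithTop ℝ≥0) < swallowingTime U x :=
      (Icc_subset_timeDomain hbT₁ ⟨ht, htb.le⟩).2
    have htT₂ : (t.toNNReal : WithTop ℝ≥0) < (b : WithTop ℝ≥0) :=
      (mem_timeDomain_coe_iff.2 ⟨ht, htb⟩).2
    have h1 := hfar t ⟨ht, htb.le⟩
    have him₁ : (g₁ t).im = 0 := IsSolution.im_eq_zero_holds hg₁ (Complex.ofReal_im x) t ht htT₁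
    have him₂ : (g₂ t).im = 0 := IsSolution.im_eq_zero_holds hg₂ (Complex.ofReal_im x) t ht htT₂
    have hp₁ : 0 < (g₁ t).re - U t.toNNReal := sub_pos.2 (hg₁.driving_lt_re hU hx ht htT₁)
    have hle := IsSolution.re_sub_driving_le_of_monotone hU hW hmono h0 hx hg₂ hg₁ ht htT₂ htT₁
    rw [norm_sub_driving_of_im_eq_zero him₁, abs_of_pos hp₁] at h1
    rw [norm_sub_driving_of_im_eq_zero him₂, abs_of_pos (by linarith)]
    linarith
  have := hg₂.coe_lt_swallowingTime_of_le_norm_sub hW hb0 hδ hfar₂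
  rw [← hb] at this
  exact lt_irrefl _ this

end Loewner

/-! ### [LSW] Lemma 8.3 (2) on the positive axis for `−2 < ρ ≤ 0` -/

/-- **[LSW] Lemma 8.3 (2), positive axis, for `−2 < ρ ≤ 0`** (p. 36: for `κ ≤ 4`, "a.s. `1 ∉ K_t`
for all `t ≥ 0`. This also implies that `K_t ∩ [1, ∞) = ∅` a.s. for all `t ≥ 0` […]
`K_∞ ∩ (0, ∞) = ∅` a.s."), read through the swallowing times of real points as in the tree's
named fact `SLEKappaRho.swallowingTime_ofReal_pos` (which asserts it for all `ρ > −2`): for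
`0 < κ ≤ 4`, `−2 < ρ ≤ 0` and an SLE(κ, ρ) driving pair `(O, W)`, almost surely no `x > 0` is
ever swallowed by the Loewner chain of `W`. Proof (replacing [LSW]'s Bessel comparison by the
first sentence of the proof of Cor. 8.6, p. 38): a.s. `W_t = √κ B_t + ρ ∫₀ᵗ du/Z_u` (§8.3,
`SLEKappaRho.ae_snd_eq_of` with `SLEKappaRho.integral_inv_eq_holds`) with `Z ≥ 0` and `ρ ≤ 0`, so
`√κ B − W` is non-decreasing and vanishes at `0`; by `Loewner.swallowingTime_le_of_monotone_sub`
the swallowing time of `x > 0` under `W` is at least that under the SLE_κ driving function `√κ B`,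
which is a.s. infinite for every `x > 0` when `κ ≤ 4` (`sle_swallowingTime_ofReal_eq_top_holds`).
[cite: LawlerSchrammWerner2003Restriction, Lemma 8.3 (2) (p. 36) with proof of Cor. 8.6 (p. 38), first sentence] -/
theorem SLEKappaRho.ae_swallowingTime_ofReal_eq_top_of_nonpos {κ : ℝ≥0} {ρ : ℝ}
    {O W : ℝ≥0 → (ℝ≥0 → ℝ) → ℝ} (hκ : 0 < κ) (hκ4 : κ ≤ 4) (hρ : -2 < ρ) (hρ0 : ρ ≤ 0)
    (hOW : IsSLEKappaRhoPair κ ρ O W) :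
    ∀ᵐ ω ∂preWienerMeasure, ∀ x : ℝ, 0 < x → Loewner.swallowingTime (fun s ↦ W s ω) x = ⊤ := by
  filter_upwards [sle_swallowingTime_ofReal_eq_top_holds hκ4,
    SLEKappaRho.ae_snd_eq_of SLEKappaRho.integral_inv_eq_holds hκ hρ hOW,
    SLEKappaRho.integral_inv_eq_holds hκ hρ hOW,
    hOW.ae_continuous SLEKappaRho.integral_inv_eq_holds hκ hρ] with ω hsle hWeq hint hcont
  intro x hx
  -- the integrand `1/Z` and its non-negativity
  set f : ℝ → ℝ := fun u ↦ (W u.toNNReal ω - O u.toNNReal ω)⁻¹ with hf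
  have hfnn : ∀ u, 0 ≤ f u := fun u ↦ inv_nonneg.2 (sub_nonneg.2 (hOW.le u.toNNReal ω))
  -- `√κ B − W = −ρ ∫₀ᵗ du/Z_u` is non-decreasing
  have hmono : Monotone fun t : ℝ≥0 ↦ sleDriving κ ω t - W t ω := by
    intro s t hst
    have hs := hWeq s
    have ht := hWeq t
    simp only [sleDriving_apply]
    rw [hs, ht]
    have hsub : (∫ u in (0 : ℝ)..(t : ℝ), f u) - ∫ u in (0 : ℝ)..(s : ℝ), f u =
        ∫ u in (s : ℝ)..(t : ℝ), f u :=
      intervalIntegral.integral_interval_sub_left (hint t).1 (hint s).1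
    have hst' : (s : ℝ) ≤ t := NNReal.coe_le_coe.2 hst
    have hnn : 0 ≤ ∫ u in (s : ℝ)..(t : ℝ), f u :=
      intervalIntegral.integral_nonneg hst' fun u _ ↦ hfnn u
    have hρ' : 0 ≤ -ρ := by linarith
    have key : -ρ * (∫ u in (0 : ℝ)..(s : ℝ), f u) ≤ -ρ * ∫ u in (0 : ℝ)..(t : ℝ), f u := by
      have : (∫ u in (0 : ℝ)..(s : ℝ), f u) ≤ ∫ u in (0 : ℝ)..(t : ℝ), f u := by linarith
      exact mul_le_mul_of_nonneg_left this hρ'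
    simp only [hf] at key
    linarith
  have h0 : (fun s ↦ W s ω) 0 ≤ sleDriving κ ω 0 := by
    simp only [hOW.snd_zero ω, sleDriving_zero]
    exact le_rfl
  have hx' : sleDriving κ ω 0 < x := by rwa [sleDriving_zero]
  have hle := Loewner.swallowingTime_le_of_monotone_sub (continuous_sleDriving κ ω) hcont.1 hmono h0 hx'
  rw [hsle x hx] at hle
  exact top_le_iff.1 hle

/-- `8/3 ≤ 4` in `ℝ≥0`. [folklore] -/
theorem eight_thirds_le_four : (8 : ℝ≥0) / 3 ≤ 4 := by
  rw [div_le_iff₀ (by norm_num : (0 : ℝ≥0) < 3)]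
  norm_num

/-- **The bundle `SLEKappaRho.PairLeaves ρ W` for `−2 < ρ ≤ 0` from the martingale leaf alone**:
the martingales of Lemmas 8.9–8.10 from `SLEKappaRho.exists_isOneSidedMartingale` (`hM`);
continuity of the paths from `∫₀ᵗ du/Z_u < ∞` (`SLEKappaRho.integral_inv_eq_holds`); `W_0 = 0`;
Lemma 8.3 (4) (`SLEKappaRho.not_isBounded_hullUnion_holds`); and Lemma 8.3 (2) on the positive axis
for `ρ ≤ 0` (`SLEKappaRho.ae_swallowingTime_ofReal_eq_top_of_nonpos`).
[cite: LawlerSchrammWerner2003Restriction, §8.3–8.4 (pp. 36–38) with Lemma 8.3 (p. 36)] -/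
theorem SLEKappaRho.pairLeaves_of_nonpos (hM : SLEKappaRho.exists_isOneSidedMartingale)
    {ρ : ℝ} {O W : ℝ≥0 → (ℝ≥0 → ℝ) → ℝ} (hρ : -2 < ρ) (hρ0 : ρ ≤ 0)
    (hOW : IsSLEKappaRhoPair (8 / 3) ρ O W) : SLEKappaRho.PairLeaves ρ W where
  exists_martingale hAs hA := hM hρ hOW hAs hA
  ae_continuous :=
    (hOW.ae_continuous SLEKappaRho.integral_inv_eq_holds (by positivity) hρ).mono fun _ h ↦ h.1
  apply_zero := hOW.snd_zero
  ae_not_isBounded := SLEKappaRho.not_isBounded_hullUnion_holds (by positivity) hρ hOW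
  ae_swallowingTime_eq_top :=
    SLEKappaRho.ae_swallowingTime_ofReal_eq_top_of_nonpos (by positivity) eight_thirds_le_four hρ hρ0 hOW

/-- **[LSW] Theorem 8.4 in law form for `−2 < ρ ≤ 0`, from the martingale leaf and Lemma 6.2**:
the random set `F^{ℝ₊}_ℍ(cl K_∞)` of SLE(8/3, ρ) has a measurable `Ω₊`-valued version whose law is
`P⁺_{α(ρ)}`, `α(ρ) = (3ρ + 10)(2 + ρ)/32` — the per-pair assembly
`IsSLEKappaRhoPair.isRightRestrictionMeasure_map_of` of `SLEKappaRhoAssembly` fed with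
`SLEKappaRho.pairLeaves_of_nonpos`, Lemma 6.2 (`h62`) and the tree's proof of Lemma 6.3
(`restrictionDerivVanishesAtHit_of_stolz IsSmoothHull.hitPath_stolz_holds`).
[cite: LawlerSchrammWerner2003Restriction, Thm. 8.4 (p. 37) with §8.1 (p. 31) and its proof (§8.4)] -/
theorem IsSLEKappaRhoPair.isRightRestrictionMeasure_map_of_nonpos
    (hM : SLEKappaRho.exists_isOneSidedMartingale) (h62 : Loewner.restrictionDeriv_exitTime_gt)
    {ρ : ℝ} {O W : ℝ≥0 → (ℝ≥0 → ℝ) → ℝ} (hρ : -2 < ρ) (hρ0 : ρ ≤ 0)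
    (hOW : IsSLEKappaRhoPair (8 / 3) ρ O W) :
    ∃ Kc : (ℝ≥0 → ℝ) → RightConfig, Measurable Kc ∧
      (∀ᵐ ω ∂preWienerMeasure, (Kc ω : Set ℂ) = sleKappaRhoFill W ω) ∧
        IsRightRestrictionMeasure (sleKappaRhoExponent ρ) (preWienerMeasure.map Kc) :=
  hOW.isRightRestrictionMeasure_map_of hρ (SLEKappaRho.pairLeaves_of_nonpos hM hρ hρ0 hOW) h62
    (restrictionDerivVanishesAtHit_of_stolz IsSmoothHull.hitPath_stolz_holds)

/-! ### The Cor. 8.6 input from four leaves -/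

/-- **The bundled Cor. 8.6 input `exists_isRightRestrictionMeasure_lt_five_eighths` from FOUR
leaves**: the one-sided restriction martingale of [LSW] Lemmas 8.9–8.10
(`hM : SLEKappaRho.exists_isOneSidedMartingale`), Lemma 6.2 for a general continuous driving
function (`h62 : Loewner.restrictionDeriv_exitTime_gt`), the symmetry sentence of p. 38 for
SLE_{8/3} (`h₀ : measure_I_notMem_leftFilling_sle_eq_half`) and the comparison sentence of p. 38
(`h₂ : SLEKappaRho.measure_I_notMem_fill_lt_of_neg`). For `0 < α < 5/8` take `ρ = ρ(α) ∈ (−2, 0)`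
and an SLE(8/3, ρ) driving pair (`exists_isSLEKappaRhoPair`); the law `Q` of the `Ω₊`-valued
version of `F^{ℝ₊}_ℍ(cl K_∞)` is `P⁺_α` (`IsSLEKappaRhoPair.isRightRestrictionMeasure_map_of_nonpos`,
using Lemma 8.3 (2) for `ρ ≤ 0` and Lemma 6.3 proved here and in the tree), and
`Q{K : i ∉ K} = P{i ∉ F^{ℝ₊}_ℍ(cl K_∞)} > 1/2` (`SLEKappaRho.one_half_lt_measure_I_notMem_fill_of_leaves`
with `SLEKappaRho.integral_inv_eq_holds`).
[cite: LawlerSchrammWerner2003Restriction, Thm. 8.4 (p. 37) with Lemma 8.3 (p. 36), §8.1 (p. 31) and proof of Cor. 8.6 (p. 38)] -/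
theorem exists_isRightRestrictionMeasure_lt_five_eighths_of_four_leaves
    (hM : SLEKappaRho.exists_isOneSidedMartingale) (h62 : Loewner.restrictionDeriv_exitTime_gt)
    (h₀ : measure_I_notMem_leftFilling_sle_eq_half)
    (h₂ : SLEKappaRho.measure_I_notMem_fill_lt_of_neg) :
    exists_isRightRestrictionMeasure_lt_five_eighths := by
  intro α hα hlt
  obtain ⟨O, W, hOW⟩ := exists_isSLEKappaRhoPair (8 / 3) (sleRhoOfExponent α)
  have hρ₁ : -2 < sleRhoOfExponent α := neg_two_lt_sleRhoOfExponent hα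
  have hρ₂ : sleRhoOfExponent α < 0 := sleRhoOfExponent_neg hlt
  obtain ⟨Kc, hKc, hae, hQ⟩ :=
    IsSLEKappaRhoPair.isRightRestrictionMeasure_map_of_nonpos hM h62 hρ₁ hρ₂.le hOW
  have hgt := SLEKappaRho.one_half_lt_measure_I_notMem_fill_of_leaves
    SLEKappaRho.integral_inv_eq_holds h₀ h₂ hρ₁ hρ₂ hOW
  rw [sleKappaRhoExponent_sleRhoOfExponent hα.le] at hQ
  refine ⟨_, hQ, ?_⟩
  rwa [SLEKappaRho.map_apply_setOf_I_notMem hKc hae]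

/-! ## Part II. Scale invariance of `P⁺_α`, and Lawler's route to the strict inequality -/

section PartTwo

open scoped Pointwise

/-! ### Dilations act on `Ω₊` ([LSW] §8.1: the right-sided restriction property is scale invariant) -/

namespace RightConfig

variable (K : RightConfig) {r : ℝ}

/-- Membership in a dilated configuration: `z ∈ rK ↔ r⁻¹z ∈ K` (`r > 0`). [folklore] -/
theorem mem_smul_coe_iff (hr : 0 < r) {z : ℂ} : z ∈ r • (K : Set ℂ) ↔ r⁻¹ • z ∈ (K : Set ℂ) :=
  Set.mem_smul_set_iff_inv_smul_mem₀ hr.ne' _ _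

/-- **Dilations preserve `Ω₊`**: for `K ∈ Ω₊` and `λ > 0`, `λK` is closed, connected, in `ℍ̄`,
meets `ℝ` exactly in `(−∞, 0]`, and `ℍ ∖ λK = λ(ℍ ∖ K)` is connected ([LSW] §8.1 p. 31: the
events `{K ∩ (λA) = ∅}` make sense in `Ω₊`, "scale invariant").
[cite: LawlerSchrammWerner2003Restriction, §8.1 p. 31 (Ω₊, scale invariance)] -/
theorem smul_coe_mem_rightConfigs (hr : 0 < r) : r • (K : Set ℂ) ∈ rightConfigs := by
  have hr0 : r ≠ 0 := hr.ne'
  refine ⟨K.isClosed.smul_of_ne_zero hr0, ?_, ?_, ?_, ?_⟩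
  · rw [← Set.image_smul]
    exact K.isConnected.image _ (continuous_const_smul r).continuousOn
  · intro z hz
    have h := K.im_nonneg ((K.mem_smul_coe_iff hr).1 hz)
    rw [Complex.real_smul, Complex.mul_im, Complex.ofReal_re, Complex.ofReal_im, zero_mul,
      add_zero] at h
    show 0 ≤ z.im
    by_contra hlt
    rw [not_le] at hlt
    have : r⁻¹ * z.im < 0 := mul_neg_of_pos_of_neg (inv_pos.2 hr) hlt
    linarith
  · ext z
    simp only [mem_inter_iff, mem_range, mem_nonposAxis_iff]
    constructor
    · rintro ⟨hz, x, rfl⟩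
      have hx : ((r⁻¹ * x : ℝ) : ℂ) ∈ (K : Set ℂ) := by
        have := (K.mem_smul_coe_iff hr).1 hz
        rwa [Complex.real_smul, ← Complex.ofReal_mul] at this
      have hle := (K.ofReal_mem_iff).1 hx
      refine ⟨Complex.ofReal_im x, ?_⟩
      rw [Complex.ofReal_re]
      by_contra hpos
      rw [not_le] at hpos
      have : 0 < r⁻¹ * x := mul_pos (inv_pos.2 hr) hpos
      linarith
    · rintro ⟨him, hre⟩
      have hz : z = ((z.re : ℝ) : ℂ) := Complex.ext (by simp) (by simp [him])
      refine ⟨?_, z.re, hz.symm⟩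
      rw [K.mem_smul_coe_iff hr, hz, Complex.real_smul, ← Complex.ofReal_mul, K.ofReal_mem_iff]
      exact mul_nonpos_of_nonneg_of_nonpos (inv_pos.2 hr).le hre
  · have heq : upperHalfPlaneSet \ r • (K : Set ℂ) =
        (fun z : ℂ ↦ r • z) '' (upperHalfPlaneSet \ (K : Set ℂ)) := by
      rw [Set.image_smul]
      ext z
      rw [Set.mem_smul_set_iff_inv_smul_mem₀ hr0, Set.mem_sdiff, Set.mem_sdiff, K.mem_smul_coe_iff hr,
        ← Set.mem_smul_set_iff_inv_smul_mem₀ hr0 upperHalfPlaneSet, smul_upperHalfPlaneSet hr]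
    rw [heq]
    exact K.isConnected_diff.image _ (continuous_const_smul r).continuousOn

/-- **The dilation `K ↦ λK` of `Ω₊`** (`λ > 0`). [cite: LawlerSchrammWerner2003Restriction, §8.1 p. 31 (scale invariance)] -/
def smul (r : ℝ) (hr : 0 < r) (K : RightConfig) : RightConfig :=
  ⟨r • (K : Set ℂ), K.smul_coe_mem_rightConfigs hr⟩

/-- The underlying set of the dilated configuration. [folklore] -/
@[simp] theorem coe_smul (hr : 0 < r) : ((smul r hr K : RightConfig) : Set ℂ) = r • (K : Set ℂ) := rfl

/-- **`{λK ∩ A = ∅} = {K ∩ λ⁻¹A = ∅}`**: the avoidance events pull back to avoidance events under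
dilation. [folklore] -/
theorem smul_preimage_avoid (hr : 0 < r) (A : Set ℂ) : smul r hr ⁻¹' avoid A = avoid (r⁻¹ • A) := by
  ext K
  simp only [mem_preimage, mem_avoid, coe_smul, Set.disjoint_left]
  constructor
  · intro h w hw hwA
    have hrw : r • w ∈ r • (K : Set ℂ) := Set.smul_mem_smul_set hw
    refine h hrw ?_
    have := (Set.mem_smul_set_iff_inv_smul_mem₀ (inv_ne_zero hr.ne') A w).1 hwA
    rwa [inv_inv] at this
  · intro h z hz hzA
    refine h ((K.mem_smul_coe_iff hr).1 hz) ?_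
    rw [Set.mem_smul_set_iff_inv_smul_mem₀ (inv_ne_zero hr.ne'), inv_inv, smul_smul,
      mul_inv_cancel₀ hr.ne', one_smul]
    exact hzA

/-- **Dilations are measurable** for the avoidance σ-field (`λ⁻¹A ∈ 𝒬₊` for `A ∈ 𝒬₊`,
`IsPlusHull.smul`). [folklore] -/
theorem measurable_smul (hr : 0 < r) : Measurable (smul r hr) := by
  refine measurable_generateFrom ?_
  rintro _ ⟨A, hA, rfl⟩
  rw [smul_preimage_avoid hr]
  exact measurableSet_avoid (hA.smul (inv_pos.2 hr))

end RightConfig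

/-- **`λ_* P⁺_α` is again a right-sided restriction measure with exponent `α`**: for `A ∈ 𝒬₊`
with restriction data `(Φ_A, Φ_A'(0))`, `λ_* Q[K ∩ A = ∅] = Q[K ∩ λ⁻¹A = ∅] = Φ'_{λ⁻¹A}(0)^α = Φ_A'(0)^α`
by "`Φ_{λA}'(0) = Φ_A'(0)`" ([LSW] p. 11; `HasRestrictionDeriv.smulHull`).
[cite: LawlerSchrammWerner2003Restriction, §8.1 p. 31 (scale invariance of P⁺_α) with Prop. 3.3 proof (p. 11)] -/
theorem IsRightRestrictionMeasure.map_smul {α : ℝ} {Q : Measure RightConfig}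
    (h : IsRightRestrictionMeasure α Q) {r : ℝ} (hr : 0 < r) :
    IsRightRestrictionMeasure α (Q.map (RightConfig.smul r hr)) := by
  haveI := h.1
  refine ⟨Measure.isProbabilityMeasure_map (RightConfig.measurable_smul hr).aemeasurable, ?_⟩
  intro A hA Φ hΦ d hd
  have hr' : 0 < r⁻¹ := inv_pos.2 hr
  rw [Measure.map_apply (RightConfig.measurable_smul hr) (RightConfig.measurableSet_avoid hA),
    RightConfig.smul_preimage_avoid hr]
  exact h.2 (hA.smul hr') (hΦ.smulHull hr') (hd.smulHull hr')

/-- **Scale invariance of `P⁺_α`: `λ_* P⁺_α = P⁺_α`** (uniqueness of `P⁺_α`, [LSW] §8.1 p. 31).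
[cite: LawlerSchrammWerner2003Restriction, §8.1 p. 31 (scale invariance and uniqueness of P⁺_α)] -/
theorem IsRightRestrictionMeasure.map_smul_eq {α : ℝ} {Q : Measure RightConfig}
    (h : IsRightRestrictionMeasure α Q) {r : ℝ} (hr : 0 < r) :
    Q.map (RightConfig.smul r hr) = Q :=
  (h.map_smul hr).unique h

/-- **`P⁺_α{λz ∉ K} = P⁺_α{z ∉ K}`** for `z ∈ ℍ`, `λ > 0`: the probability that a point lies to the
right of `K` depends only on its argument. [cite: LawlerSchrammWerner2003Restriction, §8.1 p. 31 (scale invariance of P⁺_α)] -/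
theorem IsRightRestrictionMeasure.measure_notMem_smul {α : ℝ} {Q : Measure RightConfig}
    (h : IsRightRestrictionMeasure α Q) {r : ℝ} (hr : 0 < r) {z : ℂ} (hz : z ∈ upperHalfPlaneSet) :
    Q {K : RightConfig | r • z ∉ (K : Set ℂ)} = Q {K : RightConfig | z ∉ (K : Set ℂ)} := by
  have hrz : r • z ∈ upperHalfPlaneSet := by
    rw [← smul_upperHalfPlaneSet hr]
    exact Set.smul_mem_smul_set hz
  conv_lhs => rw [← h.map_smul_eq hr]
  rw [Measure.map_apply (RightConfig.measurable_smul hr) (RightConfig.measurableSet_notMem hrz)]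
  congr 1
  ext K
  simp only [mem_preimage, mem_setOf_eq, RightConfig.coe_smul]
  rw [Set.smul_mem_smul_set_iff₀ hr.ne']

/-- The same for the complementary event: **`P⁺_α{λz ∈ K} = P⁺_α{z ∈ K}`**. [cite: LawlerSchrammWerner2003Restriction, §8.1 p. 31 (scale invariance of P⁺_α)] -/
theorem IsRightRestrictionMeasure.measure_mem_smul {α : ℝ} {Q : Measure RightConfig}
    (h : IsRightRestrictionMeasure α Q) {r : ℝ} (hr : 0 < r) {z : ℂ} (hz : z ∈ upperHalfPlaneSet) :
    Q {K : RightConfig | r • z ∈ (K : Set ℂ)} = Q {K : RightConfig | z ∈ (K : Set ℂ)} := by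
  haveI := h.1
  have hrz : r • z ∈ upperHalfPlaneSet := by
    rw [← smul_upperHalfPlaneSet hr]
    exact Set.smul_mem_smul_set hz
  have h1 : {K : RightConfig | r • z ∈ (K : Set ℂ)} = {K : RightConfig | r • z ∉ (K : Set ℂ)}ᶜ := by
    ext K; simp
  have h2 : {K : RightConfig | z ∈ (K : Set ℂ)} = {K : RightConfig | z ∉ (K : Set ℂ)}ᶜ := by
    ext K; simp
  rw [h1, h2, measure_compl (RightConfig.measurableSet_notMem hrz) (measure_ne_top _ _),
    measure_compl (RightConfig.measurableSet_notMem hz) (measure_ne_top _ _),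
    h.measure_notMem_smul hr hz]

/-- The point `i` is in the open upper half-plane. [folklore] -/
theorem I_mem_upperHalfPlaneSet : (Complex.I : ℂ) ∈ upperHalfPlaneSet := by
  show 0 < Complex.I.im
  simp

/-! ### Fatness on the imaginary axis gives `P⁺_α{i ∈ K} > 0` (scale invariance and Fubini) -/

namespace RightConfig

/-- **"`z` is to the right of `K`" is a jointly measurable relation**: the set of pairs `(z, K)`,
`z ∈ ℍ`, `K ∈ Ω₊`, with `z ∉ K` is measurable in `ℂ × Ω₊` — it is the countable union, over the
fills `D` of finite unions of dyadic squares which are `+`-hulls, of the rectangles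
`(squares ∩ ℍ) × {K ∩ D = ∅}` (`exists_dyadicUnion_isPlusHull_hpFill`, as for
`measurableSet_notMem`). [folklore] -/
theorem measurableSet_prod_notMem :
    MeasurableSet {p : ℂ × RightConfig | p.1 ∈ upperHalfPlaneSet ∧ p.1 ∉ (p.2 : Set ℂ)} := by
  have heq : {p : ℂ × RightConfig | p.1 ∈ upperHalfPlaneSet ∧ p.1 ∉ (p.2 : Set ℂ)} =
      ⋃ (n : ℕ) (F : Finset (ℤ × ℤ)) (_ : IsPlusHull (hpFill (dyadicUnion n F))),
        (dyadicUnion n F ∩ upperHalfPlaneSet) ×ˢ avoid (hpFill (dyadicUnion n F)) := by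
    ext ⟨z, K⟩
    simp only [mem_setOf_eq, mem_iUnion, mem_prod, mem_inter_iff, mem_avoid, exists_prop]
    constructor
    · rintro ⟨hz, hzK⟩
      obtain ⟨n, F, hzS, hplus, hdisj⟩ := K.exists_dyadicUnion_isPlusHull_hpFill hz hzK
      exact ⟨n, F, hplus, ⟨hzS, hz⟩, hdisj⟩
    · rintro ⟨n, F, -, ⟨hzS, hz⟩, hdisj⟩
      exact ⟨hz, fun hzK ↦ Set.disjoint_left.1 hdisj hzK (inter_subset_hpFill _ ⟨hzS, hz⟩)⟩
  rw [heq]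
  refine MeasurableSet.iUnion fun n ↦ MeasurableSet.iUnion fun F ↦ MeasurableSet.iUnion fun h ↦ ?_
  exact (isClosed_dyadicUnion.measurableSet.inter UpperHalfPlane.isOpen_upperHalfPlaneSet.measurableSet).prod
    (measurableSet_avoid h)

/-- The set of pairs `(y, K)`, `y > 0`, with `iy ∈ K` is measurable in `ℝ × Ω₊`. [folklore] -/
theorem measurableSet_prod_ofReal_mul_I_mem :
    MeasurableSet {p : ℝ × RightConfig | 0 < p.1 ∧ ((p.1 : ℂ) * Complex.I) ∈ (p.2 : Set ℂ)} := by
  have hφ : Measurable fun p : ℝ × RightConfig ↦ (((p.1 : ℂ) * Complex.I), p.2) :=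
    ((Complex.continuous_ofReal.mul continuous_const).measurable.comp measurable_fst).prodMk
      measurable_snd
  have h1 : MeasurableSet {p : ℝ × RightConfig | 0 < p.1} :=
    measurableSet_lt measurable_const measurable_fst
  have heq : {p : ℝ × RightConfig | 0 < p.1 ∧ ((p.1 : ℂ) * Complex.I) ∈ (p.2 : Set ℂ)} =
      {p : ℝ × RightConfig | 0 < p.1} \
        (fun p : ℝ × RightConfig ↦ (((p.1 : ℂ) * Complex.I), p.2)) ⁻¹'
          {p : ℂ × RightConfig | p.1 ∈ upperHalfPlaneSet ∧ p.1 ∉ (p.2 : Set ℂ)} := by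
    ext ⟨y, K⟩
    simp only [mem_setOf_eq, Set.mem_sdiff, mem_preimage, not_and, not_not]
    constructor
    · rintro ⟨hy, hmem⟩
      exact ⟨hy, fun _ ↦ hmem⟩
    · rintro ⟨hy, h⟩
      refine ⟨hy, h ?_⟩
      show 0 < ((y : ℂ) * Complex.I).im
      simpa using hy
  rw [heq]
  exact h1.diff (hφ measurableSet_prod_notMem)

end RightConfig

/-- **Fubini for the length of `K` on the imaginary axis**: for a right-sided restriction measure
`Q` with exponent `α`, `E_Q[Leb{y > 0 : iy ∈ K}] = Leb(0, ∞) · Q{i ∈ K}` (`= ∞ · Q{i ∈ K}`), since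
`Q{iy ∈ K} = Q{i ∈ K}` for every `y > 0` by scale invariance
(`IsRightRestrictionMeasure.measure_mem_smul`). [folklore] -/
theorem IsRightRestrictionMeasure.lintegral_volume_axis_mem {α : ℝ} {Q : Measure RightConfig}
    (h : IsRightRestrictionMeasure α Q) :
    ∫⁻ K, volume {y : ℝ | 0 < y ∧ ((y : ℂ) * Complex.I) ∈ (K : Set ℂ)} ∂Q =
      Q {K : RightConfig | Complex.I ∈ (K : Set ℂ)} * ∞ := by
  haveI := h.1
  set T : Set (ℝ × RightConfig) :=
    {p : ℝ × RightConfig | 0 < p.1 ∧ ((p.1 : ℂ) * Complex.I) ∈ (p.2 : Set ℂ)} with hT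
  have hTm : MeasurableSet T := RightConfig.measurableSet_prod_ofReal_mul_I_mem
  -- both iterated integrals compute `(vol ⊗ Q)(T)`
  have h1 : ((volume : Measure ℝ).prod Q) T =
      ∫⁻ K, volume {y : ℝ | 0 < y ∧ ((y : ℂ) * Complex.I) ∈ (K : Set ℂ)} ∂Q := by
    rw [Measure.prod_apply_symm hTm]
    rfl
  have h2 : ((volume : Measure ℝ).prod Q) T =
      ∫⁻ y : ℝ, Q (Prod.mk y ⁻¹' T) ∂volume := Measure.prod_apply hTm
  -- the sections: empty for `y ≤ 0`, of measure `Q{i ∈ K}` for `y > 0`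
  have hsec : ∀ y : ℝ, Q (Prod.mk y ⁻¹' T) =
      (Ioi (0 : ℝ)).indicator (fun _ ↦ Q {K : RightConfig | Complex.I ∈ (K : Set ℂ)}) y := by
    intro y
    by_cases hy : 0 < y
    · rw [indicator_of_mem (mem_Ioi.2 hy)]
      have hpre : Prod.mk y ⁻¹' T = {K : RightConfig | y • Complex.I ∈ (K : Set ℂ)} := by
        ext K
        simp only [hT, mem_preimage, mem_setOf_eq, Complex.real_smul]
        exact ⟨fun h ↦ h.2, fun h ↦ ⟨hy, h⟩⟩
      rw [hpre]
      exact h.measure_mem_smul hy I_mem_upperHalfPlaneSet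
    · rw [indicator_of_notMem (fun h ↦ hy (mem_Ioi.1 h))]
      have hpre : Prod.mk y ⁻¹' T = ∅ := by
        ext K
        simp only [hT, mem_preimage, mem_setOf_eq, mem_empty_iff_false, iff_false, not_and]
        exact fun h _ ↦ hy h
      rw [hpre, measure_empty]
  rw [← h1, h2]
  simp_rw [hsec]
  rw [lintegral_indicator_const measurableSet_Ioi, Real.volume_Ioi]

/-- **A right-sided restriction measure whose samples contain a segment of the imaginary axis with
positive probability charges `{i ∈ K}`**: if `E_Q[Leb{y > 0 : iy ∈ K}] ≠ 0` then `Q{i ∈ K} > 0`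
— the Fubini half of "`q(α) > 0`" (Lawler (2005), proof of Cor. 9.11, where positivity is read
off a construction with fat samples); what remains for the SLE(8/3, ρ) realization is the
geometric input that `F^{ℝ₊}_ℍ(cl K_∞)` is fat on the axis with positive probability.
[cite: Lawler2005, Cor. 9.11 (proof, "q(α) ∈ (0, 1)")] -/
theorem IsRightRestrictionMeasure.measure_I_mem_pos_of_lintegral_ne_zero {α : ℝ} {Q : Measure RightConfig}
    (h : IsRightRestrictionMeasure α Q)
    (hfat : ∫⁻ K, volume {y : ℝ | 0 < y ∧ ((y : ℂ) * Complex.I) ∈ (K : Set ℂ)} ∂Q ≠ 0) :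
    0 < Q {K : RightConfig | Complex.I ∈ (K : Set ℂ)} := by
  rw [h.lintegral_volume_axis_mem] at hfat
  exact pos_iff_ne_zero.2 fun h0 ↦ hfat (by rw [h0, zero_mul])

/-- The same in the complementary form used by the positivity hypotheses of this file:
`Q{i ∉ K} < 1`. [cite: Lawler2005, Cor. 9.11 (proof)] -/
theorem IsRightRestrictionMeasure.measure_I_notMem_lt_one_of_lintegral_ne_zero {α : ℝ}
    {Q : Measure RightConfig} (h : IsRightRestrictionMeasure α Q)
    (hfat : ∫⁻ K, volume {y : ℝ | 0 < y ∧ ((y : ℂ) * Complex.I) ∈ (K : Set ℂ)} ∂Q ≠ 0) :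
    Q {K : RightConfig | Complex.I ∉ (K : Set ℂ)} < 1 := by
  haveI := h.1
  have hpos := h.measure_I_mem_pos_of_lintegral_ne_zero hfat
  have hc : {K : RightConfig | Complex.I ∉ (K : Set ℂ)} = {K : RightConfig | Complex.I ∈ (K : Set ℂ)}ᶜ := by
    ext K; simp
  have hm : MeasurableSet {K : RightConfig | Complex.I ∈ (K : Set ℂ)} := by
    have := (RightConfig.measurableSet_notMem I_mem_upperHalfPlaneSet).compl
    rwa [hc, compl_compl] at this
  rw [hc, prob_compl_eq_one_sub hm]
  exact ENNReal.sub_lt_self ENNReal.one_ne_top one_ne_zero hpos.ne'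

/-! ### Lawler's inequality and its strict consequence -/

/-- **Lawler's inequality is strict where it can be** (Lawler (2005), proof of Cor. 9.11: "since
`P⁺_{α+β}` can be obtained from `P⁺_α` and `P⁺_β` by taking unions,
`q(α + β) ≥ q(α) + [1 − q(α)] q(β)`, and hence `q(α)` is strictly increasing in `α`", with
`q(γ) = P⁺_γ{z ∈ K}`): in the complementary form of the tree's
`IsRightRestrictionMeasure.measure_notMem_le_mul` (`P⁺_{α+β}{z ∉ K} ≤ P⁺_α{z ∉ K} · P⁺_β{z ∉ K}`),
if `P⁺_β{z ∉ K} < 1` and `P⁺_{α+β}{z ∉ K} > 0` then `P⁺_{α+β}{z ∉ K} < P⁺_α{z ∉ K}`.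
[cite: Lawler2005, Cor. 9.11 (proof)] -/
theorem IsRightRestrictionMeasure.measure_notMem_lt_of_add {α β : ℝ} {Q₁ Q₂ Q : Measure RightConfig}
    (h₁ : IsRightRestrictionMeasure α Q₁) (h₂ : IsRightRestrictionMeasure β Q₂)
    (h : IsRightRestrictionMeasure (α + β) Q) {z : ℂ} (hz : z ∈ upperHalfPlaneSet)
    (hpos : Q₂ {K : RightConfig | z ∉ (K : Set ℂ)} < 1)
    (hne : Q {K : RightConfig | z ∉ (K : Set ℂ)} ≠ 0) :
    Q {K : RightConfig | z ∉ (K : Set ℂ)} < Q₁ {K : RightConfig | z ∉ (K : Set ℂ)} := by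
  haveI := h₁.1
  have hle := h₁.measure_notMem_le_mul h₂ h hz
  have ha0 : Q₁ {K : RightConfig | z ∉ (K : Set ℂ)} ≠ 0 := by
    intro h0
    rw [h0, zero_mul, nonpos_iff_eq_zero] at hle
    exact hne hle
  calc Q {K : RightConfig | z ∉ (K : Set ℂ)}
      ≤ Q₁ {K : RightConfig | z ∉ (K : Set ℂ)} * Q₂ {K : RightConfig | z ∉ (K : Set ℂ)} := hle
    _ < Q₁ {K : RightConfig | z ∉ (K : Set ℂ)} * 1 :=
        ENNReal.mul_lt_mul_right ha0 (measure_ne_top _ _) hpos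
    _ = Q₁ {K : RightConfig | z ∉ (K : Set ℂ)} := mul_one _

/-! ### Lawler's Cor. 9.11: `P⁺_α{i ∉ K} > 1/2`, `0 < α < 5/8`, from existence, `q(5/8) = 1/2` and small-`β` positivity -/

/-- **Lawler (2005), Cor. 9.11 — the asymmetry `P⁺_α{i ∉ K} > 1/2`, `0 < α < 5/8`, from its three
printed inputs**, for the one-sided measures alone (no SLE): (1) existence of `P⁺_γ` for all
`γ > 0` ("the construction above"; [LSW] Prop. 8.1, the named fact
`exists_isRightRestrictionMeasure`), (2) `q(5/8) = 1/2` ("Since the hull corresponding to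
`α = 5/8` is an SLE_{8/3} curve, and the distribution of SLE_{8/3} is symmetric about the
imaginary axis, `q(5/8) = 1/2`"), (3) positivity, `q(β) > 0`, for arbitrarily small `β > 0`
("The construction above shows that `q(α) ∈ (0, 1)`"; propagated upwards by
`IsRightRestrictionMeasure.measure_notMem_lt_one_mono`): then "`q(α) < 1/2` for `α < 5/8`", i.e.
`Q{i ∉ K} > 1/2` for every right-sided restriction measure `Q` of exponent `α ∈ (0, 5/8)` (the
statement of the first half of the proof of [LSW] Cor. 8.6, p. 38, for every `P⁺_α`; by the
uniqueness of `P⁺_α` it is the second conjunct of this file's fact, see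
`exists_isRightRestrictionMeasure_lt_five_eighths_of_exists_of_pos`; the argument does not use
`0 < α`). Inputs (2) and (3) are hypotheses. [cite: Lawler2005, Cor. 9.11 (p. 219) and its proof] -/
theorem IsRightRestrictionMeasure.one_half_lt_measure_notMem_I_of_pos
    (hex : exists_isRightRestrictionMeasure)
    (hhalf : ∀ {Q : Measure RightConfig}, IsRightRestrictionMeasure (5 / 8) Q →
      Q {K : RightConfig | Complex.I ∉ (K : Set ℂ)} = 1 / 2)
    (hpos : ∀ ε : ℝ, 0 < ε → ∃ (β : ℝ) (Q : Measure RightConfig), 0 < β ∧ β ≤ ε ∧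
      IsRightRestrictionMeasure β Q ∧ Q {K : RightConfig | Complex.I ∉ (K : Set ℂ)} < 1)
    {α : ℝ} {Q : Measure RightConfig} (hQ : IsRightRestrictionMeasure α Q) (hlt : α < 5 / 8) :
    1 / 2 < Q {K : RightConfig | Complex.I ∉ (K : Set ℂ)} := by
  have hI := I_mem_upperHalfPlaneSet
  -- positivity at a small `β ≤ 5/8 − α`, moved up to `β' = 5/8 − α`
  obtain ⟨β, Qβ, hβ, hββ', hQβ, hQβlt⟩ := hpos (5 / 8 - α) (by linarith)
  obtain ⟨Qβ', hQβ'⟩ := hex (5 / 8 - α) (by linarith)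
  have hQβ'lt : Qβ' {K : RightConfig | Complex.I ∉ (K : Set ℂ)} < 1 :=
    hQβ.measure_notMem_lt_one_mono hQβ' hββ' (fun _ ↦ hex _ (by linarith)) hI hQβlt
  -- `P⁺_{5/8}`, where `{i ∉ K}` has probability `1/2`
  obtain ⟨Q58, hQ58⟩ := hex (5 / 8) (by norm_num)
  have h58 : IsRightRestrictionMeasure (α + (5 / 8 - α)) Q58 := by rwa [add_sub_cancel]
  have hne : Q58 {K : RightConfig | Complex.I ∉ (K : Set ℂ)} ≠ 0 := by
    rw [hhalf hQ58]
    norm_num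
  calc (1 / 2 : ℝ≥0∞) = Q58 {K : RightConfig | Complex.I ∉ (K : Set ℂ)} := (hhalf hQ58).symm
    _ < Q {K : RightConfig | Complex.I ∉ (K : Set ℂ)} := hQ.measure_notMem_lt_of_add hQβ' h58 hI hQβ'lt hne

/-- **This file's fact `exists_isRightRestrictionMeasure_lt_five_eighths` from Lawler's three
inputs** — existence of all `P⁺_γ` ([LSW] Prop. 8.1, `exists_isRightRestrictionMeasure`),
`P⁺_{5/8}{i ∉ K} = 1/2` and the small-`β` positivity — with no SLE(κ, ρ): existence gives the
measure, `IsRightRestrictionMeasure.one_half_lt_measure_notMem_I_of_pos` the asymmetry. This is the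
form in which the excursion-cloud construction of `P⁺_β` (Lawler (2005) §9.2, Prop. 9.13;
`OneSidedExcursionCloudMeasure`) feeds Cor. 8.6.
[cite: Lawler2005, Cor. 9.11 (p. 219) and its proof; LawlerSchrammWerner2003Restriction, proof of Cor. 8.6 (p. 38)] -/
theorem exists_isRightRestrictionMeasure_lt_five_eighths_of_exists_of_pos
    (hex : exists_isRightRestrictionMeasure)
    (hhalf : ∀ {Q : Measure RightConfig}, IsRightRestrictionMeasure (5 / 8) Q →
      Q {K : RightConfig | Complex.I ∉ (K : Set ℂ)} = 1 / 2)
    (hpos : ∀ ε : ℝ, 0 < ε → ∃ (β : ℝ) (Q : Measure RightConfig), 0 < β ∧ β ≤ ε ∧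
      IsRightRestrictionMeasure β Q ∧ Q {K : RightConfig | Complex.I ∉ (K : Set ℂ)} < 1) :
    exists_isRightRestrictionMeasure_lt_five_eighths := fun α hα hlt ↦ by
  obtain ⟨Q, hQ⟩ := hex α hα
  exact ⟨Q, hQ, IsRightRestrictionMeasure.one_half_lt_measure_notMem_I_of_pos hex hhalf hpos hQ hlt⟩

/-! ### The SLE(8/3, ρ) forms: this file's fact from the martingale and positivity -/

/-- **The asymmetry leaf `SLEKappaRho.one_half_lt_measure_I_notMem_fill` from the martingale of
Lemmas 8.9–8.10 and the small-`β` positivity**: the tree's comparison-from-positivity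
(`SLEKappaRho.measure_I_notMem_fill_lt_of_neg_of_martingale_of_pos`,
`RestrictionMeasuresFiveEighthsPositivity`) with the proved symmetry value
(`SLEKappaRho.one_half_lt_measure_I_notMem_fill_of_comparison`).
[cite: Lawler2005, Cor. 9.11 (proof); LawlerSchrammWerner2003Restriction, proof of Cor. 8.6 (p. 38)] -/
theorem SLEKappaRho.one_half_lt_measure_I_notMem_fill_of_martingale_of_pos
    (hM : SLEKappaRho.exists_isOneSidedMartingale)
    (hpos : ∀ ε : ℝ, 0 < ε → ∃ (β : ℝ) (Q : Measure RightConfig), 0 < β ∧ β ≤ ε ∧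
      IsRightRestrictionMeasure β Q ∧ Q {K : RightConfig | Complex.I ∉ (K : Set ℂ)} < 1) :
    SLEKappaRho.one_half_lt_measure_I_notMem_fill :=
  SLEKappaRho.one_half_lt_measure_I_notMem_fill_of_comparison
    (SLEKappaRho.measure_I_notMem_fill_lt_of_neg_of_martingale_of_pos hM hpos)

/-- **This file's fact `exists_isRightRestrictionMeasure_lt_five_eighths` from the martingale of
Lemmas 8.9–8.10 and the small-`β` positivity** (`P⁺_β{i ∈ K} > 0` for arbitrarily small
`β > 0`): the tree's two-leaf assembly with the comparison leaf supplied by Lawler's argument.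
What a discharge still needs: `hM` (`SLEKappaRho.exists_isOneSidedMartingale_holds`) and the
positivity, e.g. in the "fat on the axis" form below.
[cite: Lawler2005, Cor. 9.11; LawlerSchrammWerner2003Restriction, Thm. 8.4 (p. 37) and proof of Cor. 8.6 (p. 38)] -/
theorem exists_isRightRestrictionMeasure_lt_five_eighths_of_martingale_of_pos
    (hM : SLEKappaRho.exists_isOneSidedMartingale)
    (hpos : ∀ ε : ℝ, 0 < ε → ∃ (β : ℝ) (Q : Measure RightConfig), 0 < β ∧ β ≤ ε ∧
      IsRightRestrictionMeasure β Q ∧ Q {K : RightConfig | Complex.I ∉ (K : Set ℂ)} < 1) :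
    exists_isRightRestrictionMeasure_lt_five_eighths :=
  exists_isRightRestrictionMeasure_lt_five_eighths_of_two_leaves hM
    (SLEKappaRho.measure_I_notMem_fill_lt_of_neg_of_martingale_of_pos hM hpos)

/-- **Every `P⁺_α`, `0 < α < 5/8`, gives `{i ∉ K}` probability `> 1/2`, from the martingale and
the small-`β` positivity** (the asymmetry of the first half of the proof of [LSW] Cor. 8.6 for
every right-sided restriction measure of exponent `α`, i.e. the second conjunct of this file's fact
by the uniqueness of `P⁺_α`, `IsRightRestrictionMeasure.one_half_lt_measure_notMem_I_of_lt_five_eighths`).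
[cite: Lawler2005, Cor. 9.11; LawlerSchrammWerner2003Restriction, proof of Cor. 8.6 (p. 38) with §8.1 (uniqueness)] -/
theorem IsRightRestrictionMeasure.one_half_lt_measure_notMem_I_of_martingale_of_pos
    (hM : SLEKappaRho.exists_isOneSidedMartingale)
    (hpos : ∀ ε : ℝ, 0 < ε → ∃ (β : ℝ) (Q : Measure RightConfig), 0 < β ∧ β ≤ ε ∧
      IsRightRestrictionMeasure β Q ∧ Q {K : RightConfig | Complex.I ∉ (K : Set ℂ)} < 1)
    {α : ℝ} {Q : Measure RightConfig} (hQ : IsRightRestrictionMeasure α Q) (hα : 0 < α)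
    (hlt : α < 5 / 8) : 1 / 2 < Q {K : RightConfig | Complex.I ∉ (K : Set ℂ)} :=
  IsRightRestrictionMeasure.one_half_lt_measure_notMem_I_of_lt_five_eighths
    (exists_isRightRestrictionMeasure_lt_five_eighths_of_martingale_of_pos hM hpos) hQ hα hlt

/-! ### The positivity in the "fat on the imaginary axis" form -/

/-- **The fact from the martingale and FATNESS of some small-exponent `P⁺_β` on the imaginary
axis**: if for every `ε > 0` some `P⁺_β`, `0 < β ≤ ε`, has `E[Leb{y > 0 : iy ∈ K}] ≠ 0`, then
(Fubini and scale invariance, `IsRightRestrictionMeasure.measure_I_notMem_lt_one_of_lintegral_ne_zero`)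
it charges `{i ∈ K}`, and `exists_isRightRestrictionMeasure_lt_five_eighths_of_martingale_of_pos`
applies. [cite: Lawler2005, Cor. 9.11 (proof, "q(α) ∈ (0, 1)")] -/
theorem exists_isRightRestrictionMeasure_lt_five_eighths_of_martingale_of_fat
    (hM : SLEKappaRho.exists_isOneSidedMartingale)
    (hfat : ∀ ε : ℝ, 0 < ε → ∃ (β : ℝ) (Q : Measure RightConfig), 0 < β ∧ β ≤ ε ∧
      IsRightRestrictionMeasure β Q ∧
        ∫⁻ K, volume {y : ℝ | 0 < y ∧ ((y : ℂ) * Complex.I) ∈ (K : Set ℂ)} ∂Q ≠ 0) :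
    exists_isRightRestrictionMeasure_lt_five_eighths := by
  refine exists_isRightRestrictionMeasure_lt_five_eighths_of_martingale_of_pos hM fun ε hε ↦ ?_
  obtain ⟨β, Q, hβ, hβε, hQ, hne⟩ := hfat ε hε
  exact ⟨β, Q, hβ, hβε, hQ, hQ.measure_I_notMem_lt_one_of_lintegral_ne_zero hne⟩

/-- The expected length of `F^{ℝ₊}_ℍ(cl K_∞)` on the imaginary axis, computed through a measurable
`Ω₊`-valued version `Kc` (as provided by Thm. 8.4 in law form): `E[Leb{y > 0 : iy ∈ F(cl K_∞(W))}]`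
is the `Q`-integral of `Leb{y > 0 : iy ∈ K}` for the law `Q` of `Kc`. [folklore] -/
theorem SLEKappaRho.lintegral_volume_axis_mem_eq_of_version {W : ℝ≥0 → (ℝ≥0 → ℝ) → ℝ}
    {Kc : (ℝ≥0 → ℝ) → RightConfig} (hKc : Measurable Kc)
    (hae : ∀ᵐ ω ∂preWienerMeasure, (Kc ω : Set ℂ) = sleKappaRhoFill W ω) :
    ∫⁻ K, volume {y : ℝ | 0 < y ∧ ((y : ℂ) * Complex.I) ∈ (K : Set ℂ)} ∂(preWienerMeasure.map Kc) =
      ∫⁻ ω, volume {y : ℝ | 0 < y ∧ ((y : ℂ) * Complex.I) ∈ sleKappaRhoFill W ω} ∂preWienerMeasure := by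
  have hmeas : Measurable fun K : RightConfig ↦
      volume {y : ℝ | 0 < y ∧ ((y : ℂ) * Complex.I) ∈ (K : Set ℂ)} := by
    have h := measurable_measure_prodMk_right (μ := (volume : Measure ℝ))
      RightConfig.measurableSet_prod_ofReal_mul_I_mem
    exact h
  rw [lintegral_map hmeas hKc]
  refine lintegral_congr_ae (hae.mono fun ω hω ↦ ?_)
  show volume {y : ℝ | 0 < y ∧ ((y : ℂ) * Complex.I) ∈ (Kc ω : Set ℂ)} =
    volume {y : ℝ | 0 < y ∧ ((y : ℂ) * Complex.I) ∈ sleKappaRhoFill W ω}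
  rw [hω]

/-- **The fact from the martingale and the fatness of the SLE(8/3, ρ) filling on the imaginary
axis near `ρ = −2`**: it suffices that for every `ε > 0` some SLE(8/3, ρ) driving pair with
`−2 < ρ ≤ −2 + ε`, `ρ ≤ 0`, has `E[Leb{y > 0 : iy ∈ F^{ℝ₊}_ℍ(cl K_∞(W))}] ≠ 0` — i.e. with
positive probability the left filling of SLE(8/3, ρ) contains a segment of the imaginary axis
(through Thm. 8.4 the law of a version is `P⁺_{α(ρ)}`, `α(ρ) ≤ (5/16)(ρ + 2)`). This is the form in
which the geometric input of Lawler's "`q(α) ∈ (0, 1)`" would be supplied for the SLE(8/3, ρ)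
realization. [cite: Lawler2005, Cor. 9.11 (proof); LawlerSchrammWerner2003Restriction, Thm. 8.4 (p. 37)] -/
theorem exists_isRightRestrictionMeasure_lt_five_eighths_of_martingale_of_sle_fat
    (hM : SLEKappaRho.exists_isOneSidedMartingale)
    (hsle : ∀ ε : ℝ, 0 < ε → ∃ (ρ : ℝ) (O W : ℝ≥0 → (ℝ≥0 → ℝ) → ℝ), -2 < ρ ∧ ρ ≤ -2 + ε ∧ ρ ≤ 0 ∧
      IsSLEKappaRhoPair (8 / 3) ρ O W ∧
        ∫⁻ ω, volume {y : ℝ | 0 < y ∧ ((y : ℂ) * Complex.I) ∈ sleKappaRhoFill W ω}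
          ∂preWienerMeasure ≠ 0) :
    exists_isRightRestrictionMeasure_lt_five_eighths := by
  refine exists_isRightRestrictionMeasure_lt_five_eighths_of_martingale_of_fat hM fun ε hε ↦ ?_
  have h84 : SLEKappaRho.isRightRestrictionMeasure_fill :=
    SLEKappaRho.isRightRestrictionMeasure_fill_of_martingale hM
  obtain ⟨ρ, O, W, hρ, hρε, hρ0, hOW, hne⟩ := hsle (16 / 5 * ε) (by positivity)
  obtain ⟨Kc, hKc, hae, hQ⟩ := h84 hρ hOW
  refine ⟨sleKappaRhoExponent ρ, preWienerMeasure.map Kc, sleKappaRhoExponent_pos hρ, ?_, hQ, ?_⟩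
  · calc sleKappaRhoExponent ρ ≤ 5 / 16 * (ρ + 2) := sleKappaRhoExponent_le_of_nonpos hρ hρ0
      _ ≤ 5 / 16 * (16 / 5 * ε) := by gcongr; linarith
      _ = ε := by ring
  · rwa [SLEKappaRho.lintegral_volume_axis_mem_eq_of_version hKc hae]

end PartTwo

end Literature.Probability.RandomPlanarGeometry

end
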